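import Mathlib
import HarnessLib
import Summits.HubbardSuperconductivity.HubbardSuperconductivity.Theorems.KLProgrammeKLRegimeEngineScaleZeroResummedTwoLegSums
import Summits.HubbardSuperconductivity.HubbardSuperconductivity.Theorems.KLProgrammeKLRegimeEngineScaleZeroTwoLegGridSumsWeights
import Summits.HubbardSuperconductivity.HubbardSuperconductivity.Theorems.KLProgrammeKLRegimeEngineScaleZeroE4GridVertex

/-!
# K3 engine, scale-`0` two-leg step with the vertex `V_N` ALONE (K3-FLOW scale `0` at `K₀ = 0`; the K-resummed step at any frame): the
# consumers' WEIGHTED point sums `B₁` (off-diagonal first spatial moment) and `Bᵗ` (grid time distance) of `kernel₂ (effAction C V_N)`, modulo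
# ONLY the weighted covariance constant `α_w`

Cell gate-hubbard-kl, seat p3 g8; the vertex-only twins of p3 g7's `…TwoLegGridSumsWeights.twoLeg_offDiag_moment_one_sum_le` /
`twoLeg_time_sum_le` (which carry the counterterm vertex `𝒩_{K,N}`).  With the quartic grid vertex alone the `gridLabelWt`-weighted pinned
profile is EXPLICIT and trivial — `N_w(2) = |U||β|/N`, all other degrees `0` (the quartic is ultralocal: the weight is `1` on its support,
`gridLabelWt_image_eq_one_of_kernel_hubbardGridInteraction_ne_zero`) — so the only remaining covariance input is the `gridLabelWt`-pair-weighted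
row / column bound `α_w` of `C` ((E4)₀'s `hrow`/`hcol`, k3c2-p1; for the K-resummed covariance `α̃_w = 2α_w`, `…ResummedDecay(Normal)`):

* `sum_norm_kernel_hubbardGridInteraction_pinned_gridLabelWt_le` — the weighted quartic-only profile for `wt₁ = gridLabelWt ∘ gridLegPos`;
* **`twoLeg_offDiag_moment_one_sum_vertexOnly_le`** — `Σ_{p₁} [x⃗₁ ≠ x⃗₀](1+|Δx̃₀|+|Δx̃₁|)·‖kernel₂ (effAction C V_N) ((p₀,σ,+),(p₁,σ,−))‖
  ≤ 2·ρ⁻²·e‖V_N‖_{h,wt₁}·θ_w/(1−θ_w)`, `θ_w = eα_w‖V_N‖_{h,wt₁}/κ²`, `‖V_N‖_{h,wt₁} ≤ (e²(κ+ρ))⁴|U||β|/N`;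
* **`twoLeg_time_sum_vertexOnly_le`** — `Σ_{p₁} (β′/N)·circDist_N(j₀,j₁)·‖kernel₂ (effAction C V_N) ((p₀,σ,+),(p₁,σ,−))‖ ≤ ρ⁻²·e‖V_N‖_{h,wt₁}·θ_w/(1−θ_w)`.

Everything is proved; no definitions, no named facts, no sorry.  `--supports stmt-HubbardSuperconductivity-20236` (helper; re-keys verbatim to the
K3-FLOW engine child's scale-`0` rung).
-/

noncomputable section

namespace Summit.HubbardSuperconductivity.HubbardSuperconductivity.Theorems.EngineV8

set_option linter.dupNamespace false -- summit = problem name (single-conjunct summit), D-0017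

open Real Finset Literature.MathematicalPhysics.QuantumLattice Literature.Probability.LatticeModels
open Literature.Probability.LatticeModels.BattleFederbush GrassmannAlgebra
open Summit.HubbardSuperconductivity.HubbardSuperconductivity.Theorems.KLRegimeSplit

variable {L N : ℕ} [NeZero L] [NeZero N]

/-- **The `gridLabelWt`-weighted pinned profile of the quartic grid vertex alone**: `N_w(2) = |U||β|/N`, all other degrees `0` (the weight is
`1` on the support of the ultralocal quartic). -/
theorem sum_norm_kernel_hubbardGridInteraction_pinned_gridLabelWt_le (β β' U : ℝ) (m' : ℕ) (j : Fin (2 * m')) (w : GridLeg (GridPoint L N)) :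
    ∑ Y ∈ univ.filter (fun Y : Fin (2 * m') → GridLeg (GridPoint L N) => Y j = w),
        ‖kernel ℂ (hubbardGridInteraction L N β U) (2 * m') Y‖ * gridLabelWt L N β' ((univ.image Y).image gridLegPos) ≤
      (if m' = 2 then |U| * |β| / N else 0) := by
  have h := sum_norm_kernel_hubbardGridInteraction_pinned_wt_le (L := L) (N := N) β U
    (fun S : Finset (GridLeg (GridPoint L N)) => gridLabelWt L N β' (S.image gridLegPos))
    (fun X hX => gridLabelWt_image_eq_one_of_kernel_hubbardGridInteraction_ne_zero β β' U X hX) m' j w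
  simpa only using h

/-- **THE OFF-DIAGONAL FIRST SPATIAL MOMENT of the vertex-only two-leg kernel** (`B₁` at `K₀ = 0` / for the K-resummed step): with `C`
replica-Gram-bounded (`κ`), `gridLabelWt`-pair-weighted row/column sums `≤ α_w`, `θ_w = eα_w‖V_N‖_{h,wt₁}/κ² < 1` for the quartic-only
weighted profile: for every spin `σ` and grid point `p₀`,
`Σ_{p₁} [x⃗₁ ≠ x⃗₀](1+|Δx̃₀|+|Δx̃₁|)·‖kernel₂ (effAction C V_N) ((p₀,σ,+),(p₁,σ,−))‖ ≤ 2·ρ⁻²·e‖V_N‖_{h,wt₁}·θ_w/(1−θ_w)`. -/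
theorem twoLeg_offDiag_moment_one_sum_vertexOnly_le (C : Matrix (GridLeg (GridPoint L N)) (GridLeg (GridPoint L N)) ℂ) (β U : ℝ)
    {β' : ℝ} (hβ' : 0 ≤ β') {κ : ℝ} (hκ : 0 < κ) (hGB : IsGramBoundedR C κ)
    {αw : ℝ} (hαw : 0 < αw) (hrow : ∀ X, ∑ Y, ‖C X Y‖ * gridLabelWt L N β' {gridLegPos X, gridLegPos Y} ≤ αw)
    (hcol : ∀ Y, ∑ X, ‖C X Y‖ * gridLabelWt L N β' {gridLegPos X, gridLegPos Y} ≤ αw)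
    {ρ : ℝ} (hρ : 0 < ρ)
    (hθ : Real.exp 1 * αw * normV (GridLeg (GridPoint L N)) κ ρ (fun m' => if m' = 2 then |U| * |β| / N else 0) / κ ^ 2 < 1)
    (σ : Fin 2) (p₀ : GridPoint L N) :
    ∑ p₁ : GridPoint L N, (if p₁.2 - p₀.2 = 0 then (0 : ℝ) else
        (1 + (((p₁.2 - p₀.2) 0).valMinAbs.natAbs : ℝ) + (((p₁.2 - p₀.2) 1).valMinAbs.natAbs : ℝ))) *
      ‖kernel ℂ (effAction ℂ C (hubbardGridInteraction L N β U)) 2 (fun i => ((![p₀, p₁] i, σ), i))‖ ≤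
      2 * (ρ⁻¹ ^ 2 * (Real.exp 1 * normV (GridLeg (GridPoint L N)) κ ρ (fun m' => if m' = 2 then |U| * |β| / N else 0)) *
        (Real.exp 1 * αw * normV (GridLeg (GridPoint L N)) κ ρ (fun m' => if m' = 2 then |U| * |β| / N else 0) / κ ^ 2) /
          (1 - Real.exp 1 * αw * normV (GridLeg (GridPoint L N)) κ ρ (fun m' => if m' = 2 then |U| * |β| / N else 0) / κ ^ 2)) := by
  set ω : (Fin 2 → GridLeg (GridPoint L N)) → ℝ := fun Y => if (Y 1).1.1.2 - (Y 0).1.1.2 = 0 then (0 : ℝ) else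
      (1 + ((((Y 1).1.1.2 - (Y 0).1.1.2) 0).valMinAbs.natAbs : ℝ) + ((((Y 1).1.1.2 - (Y 0).1.1.2) 1).valMinAbs.natAbs : ℝ)) with hω
  have hω0 : ∀ Y, 0 ≤ ω Y := fun Y => by rw [hω]; dsimp only; split_ifs <;> positivity
  have hpair : ∀ X Y : GridLeg (GridPoint L N), ({X, Y} : Finset (GridLeg (GridPoint L N))).image gridLegPos = {gridLegPos X, gridLegPos Y} :=
    fun X Y => by rw [image_insert, image_singleton]
  have h := resummedTwoLeg_offDiag_wsum_le_of_wgridStep C β U (isTreeWeight_wt₁ (L := L) (N := N) hβ') hκ hGB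
    (fun m' => if m' = 2 then |U| * |β| / N else 0) (quarticProfile_nonneg β U N)
    (fun m' j w => by
      simpa only [Finset.image_image] using sum_norm_kernel_hubbardGridInteraction_pinned_gridLabelWt_le (L := L) (N := N) β β' U m' j w)
    hαw (fun X => by simpa only [hpair] using hrow X) (fun Y => by simpa only [hpair] using hcol Y) hρ hθ ω
    (fun Y hY => by simpa only [hω, pow_one] using offDiagMomentWeight_eq_zero_of_point_eq 1 Y hY) zero_le_two
    (fun Y => by simpa only [hω, Finset.image_image] using offDiagMomentWeight_le_two_mul_wt₁ (L := L) (N := N) hβ' Y) (((p₀, σ), 0))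
  refine le_trans ?_ h
  refine le_trans (le_of_eq ?_) (sum_point_string_le_sum_pinned
    (fun Y => ω Y * ‖kernel ℂ (effAction ℂ C (hubbardGridInteraction L N β U)) 2 Y‖) (fun Y => mul_nonneg (hω0 Y) (norm_nonneg _)) σ p₀)
  refine sum_congr rfl fun p₁ _ => ?_
  simp only [hω, Matrix.cons_val_zero, Matrix.cons_val_one, Matrix.cons_val_fin_one]

/-- **THE TEMPORAL FIRST MOMENT of the vertex-only two-leg kernel** (`Bᵗ`, circular grid distance): same hypotheses as
`twoLeg_offDiag_moment_one_sum_vertexOnly_le`: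
`Σ_{p₁} (β′/N)·circDist_N(j₀, j₁)·‖kernel₂ (effAction C V_N) ((p₀,σ,+),(p₁,σ,−))‖ ≤ ρ⁻²·e‖V_N‖_{h,wt₁}·θ_w/(1−θ_w)`. -/
theorem twoLeg_time_sum_vertexOnly_le (C : Matrix (GridLeg (GridPoint L N)) (GridLeg (GridPoint L N)) ℂ) (β U : ℝ)
    {β' : ℝ} (hβ' : 0 ≤ β') {κ : ℝ} (hκ : 0 < κ) (hGB : IsGramBoundedR C κ)
    {αw : ℝ} (hαw : 0 < αw) (hrow : ∀ X, ∑ Y, ‖C X Y‖ * gridLabelWt L N β' {gridLegPos X, gridLegPos Y} ≤ αw)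
    (hcol : ∀ Y, ∑ X, ‖C X Y‖ * gridLabelWt L N β' {gridLegPos X, gridLegPos Y} ≤ αw)
    {ρ : ℝ} (hρ : 0 < ρ)
    (hθ : Real.exp 1 * αw * normV (GridLeg (GridPoint L N)) κ ρ (fun m' => if m' = 2 then |U| * |β| / N else 0) / κ ^ 2 < 1)
    (σ : Fin 2) (p₀ : GridPoint L N) :
    ∑ p₁ : GridPoint L N, β' / N * (circDist N p₀.1.val p₁.1.val : ℝ) *
      ‖kernel ℂ (effAction ℂ C (hubbardGridInteraction L N β U)) 2 (fun i => ((![p₀, p₁] i, σ), i))‖ ≤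
      ρ⁻¹ ^ 2 * (Real.exp 1 * normV (GridLeg (GridPoint L N)) κ ρ (fun m' => if m' = 2 then |U| * |β| / N else 0)) *
        (Real.exp 1 * αw * normV (GridLeg (GridPoint L N)) κ ρ (fun m' => if m' = 2 then |U| * |β| / N else 0) / κ ^ 2) /
          (1 - Real.exp 1 * αw * normV (GridLeg (GridPoint L N)) κ ρ (fun m' => if m' = 2 then |U| * |β| / N else 0) / κ ^ 2) := by
  set ω : (Fin 2 → GridLeg (GridPoint L N)) → ℝ := fun Y => β' / N * (circDist N (Y 0).1.1.1.val (Y 1).1.1.1.val : ℝ) with hω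
  have hω0 : ∀ Y, 0 ≤ ω Y := fun Y => by rw [hω]; exact mul_nonneg (div_nonneg hβ' (Nat.cast_nonneg _)) (Nat.cast_nonneg _)
  have hpair : ∀ X Y : GridLeg (GridPoint L N), ({X, Y} : Finset (GridLeg (GridPoint L N))).image gridLegPos = {gridLegPos X, gridLegPos Y} :=
    fun X Y => by rw [image_insert, image_singleton]
  have h := resummedTwoLeg_offDiag_wsum_le_of_wgridStep C β U (isTreeWeight_wt₁ (L := L) (N := N) hβ') hκ hGB
    (fun m' => if m' = 2 then |U| * |β| / N else 0) (quarticProfile_nonneg β U N)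
    (fun m' j w => by
      simpa only [Finset.image_image] using sum_norm_kernel_hubbardGridInteraction_pinned_gridLabelWt_le (L := L) (N := N) β β' U m' j w)
    hαw (fun X => by simpa only [hpair] using hrow X) (fun Y => by simpa only [hpair] using hcol Y) hρ hθ ω
    (fun Y hY => timeWeight_eq_zero_of_point_eq β' Y hY) zero_le_one
    (fun Y => by simpa only [hω, Finset.image_image, one_mul] using timeWeight_le_wt₁ (L := L) (N := N) β' Y) (((p₀, σ), 0))
  rw [one_mul] at h
  refine le_trans ?_ h
  refine le_trans (le_of_eq ?_) (sum_point_string_le_sum_pinned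
    (fun Y => ω Y * ‖kernel ℂ (effAction ℂ C (hubbardGridInteraction L N β U)) 2 Y‖) (fun Y => mul_nonneg (hω0 Y) (norm_nonneg _)) σ p₀)
  refine sum_congr rfl fun p₁ _ => ?_
  simp only [hω, Matrix.cons_val_zero, Matrix.cons_val_one, Matrix.cons_val_fin_one]

end Summit.HubbardSuperconductivity.HubbardSuperconductivity.Theorems.EngineV8

end
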